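import Mathlib.GroupTheory.Perm.Cycle.Factors

/-!
# Route «KPlusLogSqLaw», crux `TropicalB` (stmt-ValiantsHypothesis-19771) — MARKED-EDGE sector, FOUR-BIT LAW, part 1:
# cyclic order along one cycle of a permutation (pure combinatorics, no design vocabulary)

HONEST FRAMING.  Helper file (cell `pub-symmetroid`, seat val-sym-trop-p4 (g16), 2026-08-28; `--supports stmt-ValiantsHypothesis-19771
--as helper`).  First of the files that put the lineage's paper theorem «MARKED-EDGE FOUR-BIT LAW» (g15, HOME/val-sym-trop-p4/g15/THEOREM-FOURBIT.md:
no marked-edge design, on any number of nodes, has the four patterns `{0,1,2}`, `{0,3}`, `{1,3}`, `{2,3}` simultaneously dominant) into the kernel.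
This part is elementary bookkeeping about ONE permutation `X` of a finite type: the ternary relation «starting from `a` and iterating `X`, the
point `b` is met before the point `c`», written INLINE (the file introduces no definition) as
`∃ n, (X ^ n) a = b ∧ ∀ k < n, (X ^ k) a ≠ c`.  Nothing here concerns designs, `TropicalB`, `WeakLifting`, the doors, `MatrixDescartes`
(stmt-ValiantsHypothesis-18050) or VP ≠ VNP.

CONTENTS (all `[folklore]`, stated for `X : Equiv.Perm V`, `V` finite):
* `exists_min_pow_eq` — a reachable point is reached at a least exponent;
* `pow_apply_eq_self_of_pow_apply_eq_self` — a power fixing one point of an orbit fixes the whole orbit;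
* `before_or_before` — two points of the orbit of `a` are met in some order;
* `eq_of_before_of_before` — … in only one order;
* `before_rotate` — «from `a`, `b` before `c`» ⇒ «from `b`, `c` before `a`» (cyclic rotation).
Parts 2–4 (theta lemma, order contradiction, exchange lemmas, assembly) import this file.
-/

set_option linter.dupNamespace false
set_option autoImplicit false

namespace Summit.ValiantsHypothesis.ValiantsHypothesis.Theorems.KPlusLogSqLaw
namespace MarkedEdge
namespace FourBit

variable {V : Type*}

/-- A property of naturals that holds somewhere holds at a least witness. [folklore] -/
theorem exists_min_nat {p : ℕ → Prop} (h : ∃ n, p n) : ∃ n, p n ∧ ∀ k < n, ¬ p k := by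
  classical
  exact ⟨Nat.find h, Nat.find_spec h, fun k hk => Nat.find_min h hk⟩

/-- If `b` is reached from `a` by iterating the permutation `X`, it is reached at a least exponent. [folklore] -/
theorem exists_min_pow_eq (X : Equiv.Perm V) {a b : V} (h : ∃ n : ℕ, (X ^ n) a = b) :
    ∃ n : ℕ, (X ^ n) a = b ∧ ∀ k < n, (X ^ k) a ≠ b :=
  exists_min_nat h

/-- Powers of one permutation commute on points: `(X^i) ((X^j) a) = (X^j) ((X^i) a)`. [folklore] -/
theorem pow_apply_comm (X : Equiv.Perm V) (i j : ℕ) (a : V) : (X ^ i) ((X ^ j) a) = (X ^ j) ((X ^ i) a) := by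
  rw [← Equiv.Perm.mul_apply, ← pow_add, add_comm, pow_add, Equiv.Perm.mul_apply]

/-- `(X^(i+j)) a = (X^i) ((X^j) a)`. [folklore] -/
theorem pow_add_apply (X : Equiv.Perm V) (i j : ℕ) (a : V) : (X ^ (i + j)) a = (X ^ i) ((X ^ j) a) := by
  rw [pow_add, Equiv.Perm.mul_apply]

/-- A power of `X` fixing one point `u` fixes every point `(X^j) u` of its orbit. [folklore] -/
theorem pow_apply_eq_self_of_pow_apply_eq_self (X : Equiv.Perm V) {d : ℕ} {u : V} (hu : (X ^ d) u = u) (j : ℕ) :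
    (X ^ d) ((X ^ j) u) = (X ^ j) u := by
  rw [pow_apply_comm, hu]

/-- If `(X^n) a = b` with `n` least and `(X^e) a = a` for some `1 ≤ e`, then `n < e`: the orbit does not close up before
reaching `b`. [folklore] -/
theorem min_pow_lt_of_pow_apply_eq_self (X : Equiv.Perm V) {a b : V} {n e : ℕ} (hn : (X ^ n) a = b)
    (hmin : ∀ k < n, (X ^ k) a ≠ b) (he : 1 ≤ e) (hfix : (X ^ e) a = a) : n < e := by
  by_contra hcon
  push Not at hcon
  -- then `(X^(n-e)) a = b` with `n - e < n`
  have h1 : (X ^ (n - e)) a = b := by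
    have : (X ^ (n - e)) ((X ^ e) a) = b := by rw [← pow_add_apply, Nat.sub_add_cancel hcon, hn]
    rwa [hfix] at this
  exact hmin (n - e) (by omega) h1

/-- **Two points of one orbit are met in some order.**  If `b` and `c` are both reached from `a` by iterating `X`, then
either `b` is met before `c` or `c` before `b` (both when `b = c`). [folklore] -/
theorem before_or_before (X : Equiv.Perm V) {a b c : V} (hb : ∃ n : ℕ, (X ^ n) a = b) (hc : ∃ n : ℕ, (X ^ n) a = c) :
    (∃ n : ℕ, (X ^ n) a = b ∧ ∀ k < n, (X ^ k) a ≠ c) ∨ (∃ n : ℕ, (X ^ n) a = c ∧ ∀ k < n, (X ^ k) a ≠ b) := by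
  obtain ⟨nb, hnb, hminb⟩ := exists_min_pow_eq X hb
  obtain ⟨nc, hnc, hminc⟩ := exists_min_pow_eq X hc
  rcases le_or_gt nb nc with h | h
  · exact Or.inl ⟨nb, hnb, fun k hk => hminc k (lt_of_lt_of_le hk h)⟩
  · exact Or.inr ⟨nc, hnc, fun k hk => hminb k (hk.trans h)⟩

/-- **… and in only one order.**  If from `a` the point `b` is met before `c` and `c` before `b`, then `b = c`. [folklore] -/
theorem eq_of_before_of_before (X : Equiv.Perm V) {a b c : V}
    (h₁ : ∃ n : ℕ, (X ^ n) a = b ∧ ∀ k < n, (X ^ k) a ≠ c) (h₂ : ∃ n : ℕ, (X ^ n) a = c ∧ ∀ k < n, (X ^ k) a ≠ b) : b = c := by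
  obtain ⟨n, hn, hmin⟩ := h₁
  obtain ⟨n', hn', hmin'⟩ := h₂
  rcases lt_trichotomy n n' with h | h | h
  · exact absurd hn (hmin' n h)
  · subst h; exact hn.symm.trans hn'
  · exact absurd hn' (hmin n' h)

/-- **Cyclic rotation.**  If `a ≠ b`, from `a` the point `b` is met before `c`, and `c` lies on the orbit of `a`, then from `b`
the point `c` is met before `a`. [folklore] -/
theorem before_rotate (X : Equiv.Perm V) {a b c : V} (hab : a ≠ b)
    (h : ∃ n : ℕ, (X ^ n) a = b ∧ ∀ k < n, (X ^ k) a ≠ c) (hc : ∃ n : ℕ, (X ^ n) a = c) :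
    ∃ n : ℕ, (X ^ n) b = c ∧ ∀ k < n, (X ^ k) b ≠ a := by
  obtain ⟨n, hn, hmin⟩ := h
  obtain ⟨n', hn', hmin'⟩ := exists_min_pow_eq X hc
  -- `n ≤ n'` since `c` is not met strictly before `b`
  have hle : n ≤ n' := by
    by_contra hlt; push Not at hlt; exact hmin n' hlt hn'
  have hn1 : 1 ≤ n := by
    rcases Nat.eq_zero_or_pos n with rfl | hpos
    · exact absurd (by simpa using hn) hab
    · exact hpos
  refine ⟨n' - n, ?_, fun k hk => ?_⟩
  · rw [← hn, ← pow_add_apply, Nat.sub_add_cancel hle, hn']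
  · intro hk'
    -- `(X^(n+k)) a = a` with `1 ≤ n + k ≤ n'`: the orbit closes before reaching `c`, contradiction
    have hfix : (X ^ (k + n)) a = a := by rw [pow_add_apply, hn, hk']
    have := min_pow_lt_of_pow_apply_eq_self X hn' hmin' (by omega) hfix
    omega


/-! ### The theta lemma: two cycles `X`, `Y` with «no third cover inside `supp (1 ⊎ X ⊎ Y)`»

Throughout: `X Y : Equiv.Perm V`, `V` finite; the hypothesis
`hT : ∀ ρ : Equiv.Perm V, (∀ i, ρ i = i ∨ ρ i = X i ∨ ρ i = Y i) → ρ = 1 ∨ ρ = X ∨ ρ = Y`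
(«every permutation built from fixed points, `X`-arcs and `Y`-arcs is trivial, `X` or `Y`») is what the exchange lemma of part 3
delivers for two covers `X = D⁻¹A`, `Y = D⁻¹B` of a dominant triple `(D, A, B)`.  A DIVERGENCE POINT is a point moved by both `X`
and `Y` at which `X ≠ Y`. -/

/-- Iterating `X` from a point `u` moved by `X` stays among points moved by `X`. [folklore] -/
theorem pow_apply_ne_self (X : Equiv.Perm V) {u : V} (hu : X u ≠ u) (k : ℕ) : X ((X ^ k) u) ≠ (X ^ k) u := by
  rwa [Ne, Equiv.Perm.apply_pow_apply_eq_iff]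

/-- **Theta lemma (at most one divergence point).**  Let `X`, `Y` be cycles such that every permutation `ρ` with
`ρ i ∈ {i, X i, Y i}` for all `i` is `1`, `X` or `Y`.  Then there is at most one point moved by both `X` and `Y` at which
`X` and `Y` disagree.  (Proof: from a divergence point `u`, follow `X` to the first point `v ≠ u` moved by `Y`, then follow `Y`
back to `u`; this closed walk is a permutation `ρ` of the forbidden kind; `ρ ≠ 1, Y` at `u`, and `ρ = X` forces every other
common moved point to lie on the `Y`-leg, where `X = Y`.) [this seat's lemma; THEOREM-FOURBIT.md Lemma 4] -/
theorem divergence_unique [Finite V] [DecidableEq V] (X Y : Equiv.Perm V) (hX : X.IsCycle) (hY : Y.IsCycle)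
    (hT : ∀ ρ : Equiv.Perm V, (∀ i, ρ i = i ∨ ρ i = X i ∨ ρ i = Y i) → ρ = 1 ∨ ρ = X ∨ ρ = Y)
    {u u' : V} (hu : X u ≠ u) (huY : Y u ≠ u) (hdu : X u ≠ Y u)
    (hu' : X u' ≠ u') (hu'Y : Y u' ≠ u') (hdu' : X u' ≠ Y u') : u = u' := by
  by_contra hne
  -- `u' = (X^j) u` with `j ≥ 1` least
  obtain ⟨j, hj, hjmin⟩ := exists_min_pow_eq X (hX.exists_pow_eq hu hu')
  have hj1 : 1 ≤ j := by
    rcases Nat.eq_zero_or_pos j with rfl | h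
    · exact absurd (by simpa using hj) hne
    · exact h
  -- `n ≥ 1` least with `(X^n) u` moved by `Y`; `v := (X^n) u`
  obtain ⟨n, ⟨hn1, hnY⟩, hnmin⟩ : ∃ n : ℕ, (1 ≤ n ∧ Y ((X ^ n) u) ≠ (X ^ n) u) ∧ ∀ k < n, ¬ (1 ≤ k ∧ Y ((X ^ k) u) ≠ (X ^ k) u) :=
    exists_min_nat ⟨j, hj1, by rw [hj]; exact hu'Y⟩
  have hnj : n ≤ j := by
    by_contra h; push Not at h; exact hnmin j h ⟨hj1, by rw [hj]; exact hu'Y⟩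
  -- no return to `u` at exponents `1 ≤ e ≤ j`
  have hnoret : ∀ e, 1 ≤ e → e ≤ j → (X ^ e) u ≠ u := by
    intro e he1 hej hfix
    have := min_pow_lt_of_pow_apply_eq_self X hj hjmin he1 hfix
    omega
  set v := (X ^ n) u with hv
  have hvu : v ≠ u := hnoret n hn1 hnj
  -- interior of the `X`-leg is fixed by `Y`
  have hint : ∀ k, 1 ≤ k → k < n → Y ((X ^ k) u) = (X ^ k) u := by
    intro k hk1 hkn
    by_contra h
    exact hnmin k hkn ⟨hk1, h⟩
  -- `n' ≥ 1` least with `(Y^n') v = u`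
  obtain ⟨n', hn', hn'min⟩ := exists_min_pow_eq Y (hY.exists_pow_eq hnY huY)
  have hn'1 : 1 ≤ n' := by
    rcases Nat.eq_zero_or_pos n' with rfl | h
    · exact absurd (by simpa using hn') hvu
    · exact h
  -- membership predicates of the two legs (written as existentials)
  -- P i :↔ ∃ k < n, (X^k) u = i ;  Q i :↔ ∃ k < n', (Y^k) v = i
  have hPu : ∃ k < n, (X ^ k) u = u := ⟨0, by omega, by simp⟩
  have hQv : ∃ k < n', (Y ^ k) v = v := ⟨0, by omega, by simp⟩
  -- (P2) a point of the `X`-leg other than `u` is fixed by `Y`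
  have hP2 : ∀ i, (∃ k < n, (X ^ k) u = i) → i ≠ u → Y i = i := by
    rintro i ⟨k, hk, rfl⟩ hiu
    have hk1 : 1 ≤ k := by
      rcases Nat.eq_zero_or_pos k with rfl | h
      · exact absurd (by simp) hiu
      · exact h
    exact hint k hk1 hk
  -- (Q4) the `Y`-leg consists of points moved by `Y`
  have hQ4 : ∀ i, (∃ k < n', (Y ^ k) v = i) → Y i ≠ i := by
    rintro i ⟨k, hk, rfl⟩
    exact pow_apply_ne_self Y hnY k
  -- (Q2) `u` is not on the `Y`-leg
  have hQ2 : ¬ ∃ k < n', (Y ^ k) v = u := by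
    rintro ⟨k, hk, hku⟩; exact hn'min k hk hku
  -- the legs are disjoint
  have hPQ : ∀ i, (∃ k < n, (X ^ k) u = i) → ¬ ∃ k < n', (Y ^ k) v = i := by
    intro i hP hQ
    have h1 := hQ4 i hQ
    by_cases hiu : i = u
    · subst hiu; exact hQ2 hQ
    · exact h1 (hP2 i hP hiu)
  -- (P3) `X` maps the `X`-leg into the `X`-leg ∪ {v}
  have hP3 : ∀ i, (∃ k < n, (X ^ k) u = i) → (∃ k < n, (X ^ k) u = X i) ∨ X i = v := by
    rintro i ⟨k, hk, rfl⟩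
    by_cases h : k + 1 < n
    · exact Or.inl ⟨k + 1, h, by rw [pow_succ', Equiv.Perm.mul_apply]⟩
    · right
      have : k + 1 = n := by omega
      rw [hv, ← this, pow_succ', Equiv.Perm.mul_apply]
  -- (Q3) `Y` maps the `Y`-leg into the `Y`-leg ∪ {u}
  have hQ3 : ∀ i, (∃ k < n', (Y ^ k) v = i) → (∃ k < n', (Y ^ k) v = Y i) ∨ Y i = u := by
    rintro i ⟨k, hk, rfl⟩
    by_cases h : k + 1 < n'
    · exact Or.inl ⟨k + 1, h, by rw [pow_succ', Equiv.Perm.mul_apply]⟩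
    · right
      have : k + 1 = n' := by omega
      rw [← hn', ← this, pow_succ', Equiv.Perm.mul_apply]
  -- (P5) `X i ≠ u` on the `X`-leg (no early return)
  have hP5 : ∀ i, (∃ k < n, (X ^ k) u = i) → X i ≠ u := by
    rintro i ⟨k, hk, rfl⟩ h
    apply hnoret (k + 1) (by omega) (by omega)
    rw [pow_succ', Equiv.Perm.mul_apply, h]
  -- (Q6) `Y i ≠ v` on the `Y`-leg (no early return)
  have hQ6 : ∀ i, (∃ k < n', (Y ^ k) v = i) → Y i ≠ v := by
    rintro i ⟨k, hk, rfl⟩ h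
    have hfix : (Y ^ (k + 1)) v = v := by rw [pow_succ', Equiv.Perm.mul_apply, h]
    have := min_pow_lt_of_pow_apply_eq_self Y hn' hn'min (by omega) hfix
    omega
  -- the spliced map
  classical
  let f : V → V := fun i => if (∃ k < n, (X ^ k) u = i) then X i else if (∃ k < n', (Y ^ k) v = i) then Y i else i
  have hfP : ∀ i, (∃ k < n, (X ^ k) u = i) → f i = X i := fun i h => by simp only [f, if_pos h]
  have hfQ : ∀ i, (∃ k < n', (Y ^ k) v = i) → f i = Y i := fun i h => by
    simp only [f, if_neg (fun hP => hPQ i hP h), if_pos h]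
  have hfR : ∀ i, (¬ ∃ k < n, (X ^ k) u = i) → (¬ ∃ k < n', (Y ^ k) v = i) → f i = i := fun i h1 h2 => by
    simp only [f, if_neg h1, if_neg h2]
  -- values of `f` on the legs stay in the union of the legs
  have hfPmem : ∀ i, (∃ k < n, (X ^ k) u = i) →
      (∃ k < n, (X ^ k) u = f i) ∨ (∃ k < n', (Y ^ k) v = f i) := by
    intro i hP
    rw [hfP i hP]
    rcases hP3 i hP with h | h
    · exact Or.inl h
    · exact Or.inr (h ▸ hQv)
  have hfQmem : ∀ i, (∃ k < n', (Y ^ k) v = i) →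
      (∃ k < n, (X ^ k) u = f i) ∨ (∃ k < n', (Y ^ k) v = f i) := by
    intro i hQ
    rw [hfQ i hQ]
    rcases hQ3 i hQ with h | h
    · exact Or.inr h
    · exact Or.inl (h ▸ hPu)
  -- injectivity
  have hinj : Function.Injective f := by
    intro i j hij
    by_cases hiP : ∃ k < n, (X ^ k) u = i
    · by_cases hjP : ∃ k < n, (X ^ k) u = j
      · rw [hfP i hiP, hfP j hjP] at hij; exact X.injective hij
      by_cases hjQ : ∃ k < n', (Y ^ k) v = j
      · -- `X i = Y j`: `X i ∈ P ∪ {v}`, `Y j ∈ Q ∪ {u}`, `X i ≠ u`, `Y j ≠ v`, `P ∩ Q = ∅`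
        exfalso
        rw [hfP i hiP, hfQ j hjQ] at hij
        rcases hP3 i hiP with h | h
        · rcases hQ3 j hjQ with h' | h'
          · exact hPQ _ h (hij ▸ h')
          · exact hP5 i hiP (hij.trans h')
        · exact hQ6 j hjQ (hij ▸ h)
      · exfalso
        rw [hfR j hjP hjQ] at hij
        rcases hfPmem i hiP with h | h
        · exact hjP (hij ▸ h)
        · exact hjQ (hij ▸ h)
    by_cases hiQ : ∃ k < n', (Y ^ k) v = i
    · by_cases hjP : ∃ k < n, (X ^ k) u = j
      · exfalso
        rw [hfQ i hiQ, hfP j hjP] at hij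
        rcases hP3 j hjP with h | h
        · rcases hQ3 i hiQ with h' | h'
          · exact hPQ _ h (hij ▸ h')
          · exact hP5 j hjP (hij.symm.trans h')
        · exact hQ6 i hiQ (hij.symm ▸ h)
      by_cases hjQ : ∃ k < n', (Y ^ k) v = j
      · rw [hfQ i hiQ, hfQ j hjQ] at hij; exact Y.injective hij
      · exfalso
        rw [hfR j hjP hjQ] at hij
        rcases hfQmem i hiQ with h | h
        · exact hjP (hij ▸ h)
        · exact hjQ (hij ▸ h)
    · by_cases hjP : ∃ k < n, (X ^ k) u = j
      · exfalso
        rw [hfR i hiP hiQ] at hij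
        rcases hfPmem j hjP with h | h
        · exact hiP (hij ▸ h)
        · exact hiQ (hij ▸ h)
      by_cases hjQ : ∃ k < n', (Y ^ k) v = j
      · exfalso
        rw [hfR i hiP hiQ] at hij
        rcases hfQmem j hjQ with h | h
        · exact hiP (hij ▸ h)
        · exact hiQ (hij ▸ h)
      · rwa [hfR i hiP hiQ, hfR j hjP hjQ] at hij
  have hbij : Function.Bijective f := Finite.injective_iff_bijective.mp hinj
  -- the forbidden permutation
  have hρ := hT (Equiv.ofBijective f hbij) (fun i => by
    change f i = i ∨ f i = X i ∨ f i = Y i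
    by_cases hP : ∃ k < n, (X ^ k) u = i
    · exact Or.inr (Or.inl (hfP i hP))
    by_cases hQ : ∃ k < n', (Y ^ k) v = i
    · exact Or.inr (Or.inr (hfQ i hQ))
    · exact Or.inl (hfR i hP hQ))
  have hfu : f u = X u := hfP u hPu
  rcases hρ with h | h | h
  · -- `ρ = 1`: but `ρ u = X u ≠ u`
    have : f u = u := by simpa using congrArg (fun ρ : Equiv.Perm V => ρ u) h
    exact hu (hfu ▸ this)
  · -- `ρ = X`: look at `u'`
    have hfu' : f u' = X u' := by simpa using congrArg (fun ρ : Equiv.Perm V => ρ u') h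
    by_cases hP : ∃ k < n, (X ^ k) u = u'
    · exact hu'Y (hP2 u' hP (Ne.symm hne))
    by_cases hQ : ∃ k < n', (Y ^ k) v = u'
    · exact hdu' (hfu'.symm.trans (hfQ u' hQ))
    · exact hu' (hfu'.symm.trans (hfR u' hP hQ))
  · -- `ρ = Y`: but `ρ u = X u ≠ Y u`
    have : f u = Y u := by simpa using congrArg (fun ρ : Equiv.Perm V => ρ u) h
    exact hdu (hfu ▸ this)

end FourBit
end MarkedEdge
end Summit.ValiantsHypothesis.ValiantsHypothesis.Theorems.KPlusLogSqLaw
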